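import Summits.RiemannHypothesis.RiemannHypothesis.Theorems.WeilFormatCPolyWindowConstantsBox
import Literature.Analysis.SpecialFunctions.HurwitzZetaRationalEnclosure
import Literature.NumberTheory.LFunctions.YoshidaWindowGramEntryBox
import HarnessLib

/-!
# Format C, design C∞ — (E) side I-b: the certified table of window constants `W_1(a), …, W_P(a)`

Route context: Fourier–Galerkin / Schur-complement certificates of Weil positivity on a window ("format C", design C∞;
`run/shared/lean/pub/rh-explicit/rh-explicit-weil-10/KERNEL-LEVER.md` §17; supporting stmt-RiemannHypothesis-0098; seats
rh-explicit-weil-2 / weil-10).  Closes the loop of `WeilFormatCPolyWindowConstantsBox.lean`: the Hurwitz-type input box of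
`winConstBox` is produced by the rational Euler–Maclaurin enclosure `Literature.Analysis.SpecialFunctions.hurwitzNatMain/Tail`
(`abs_tsum_inv_pow_sub_hurwitzNatMain_le`), giving a parameter record `WinConst.Params` and a self-contained box
`winConstBoxP prm a p ∋ W_p(a)` (`mem_winConstBoxP`); and a CLAIMED TABLE `tab : List MI` (entry `i` ↔ `W_{i+1}(a)`) is
certified by recomputation + containment (`checkWinConstTable`, `mem_of_checkWinConstTable`) — the shape in which generated rung files state their window constants and discharge them by
`decide`.  Interval plumbing only; standard axioms; no RH claim.
-/

set_option autoImplicit false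
-- `Summit.RiemannHypothesis.RiemannHypothesis.…` is the layout-mandated namespace (summit = problem name).
set_option linter.dupNamespace false

open Complex Filter Set MeasureTheory Finset
open scoped Real Topology

namespace Summit.RiemannHypothesis.RiemannHypothesis.Theorems.WeilFormatC

open Literature.NumberTheory.LFunctions Literature.Analysis.SpecialFunctions
open Literature.Analysis.ValidatedNumerics Literature.Analysis.ValidatedNumerics.NumericsMP
open Literature.NumberTheory.LFunctions.Yoshida1992.Encl (within mem_of_within)

namespace WinConst

/-! ## The Hurwitz-type input box -/

/-- Box for `Σ_{j≥0} (j + K + ¼)^{−(p+1)}` from the rational Euler–Maclaurin main terms ± the remainder majorant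
(shift `J`, order `ν`). -/
def hurwitzBox (S J ν K p : ℕ) : MI :=
  let c : ℚ := (K : ℚ) + 1 / 4
  let m := hurwitzNatMain c J ν (p + 1)
  let t := hurwitzNatTail c J ν (p + 1)
  ⟨(ratBox S (m - t)).lo, (ratBox S (m + t)).hi⟩

/-- **`hurwitzBox` contains the sum of `Σ_{j≥0} (j + K + ¼)^{−(p+1)}`** (`p ≥ 1`, `ν ≥ 1`). -/
theorem hurwitzBox_spec (S J : ℕ) {ν : ℕ} (hν : ν ≠ 0) (K : ℕ) {p : ℕ} (hp : 1 ≤ p) :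
    ∃ h : ℝ, HasSum (fun j : ℕ ↦ ((((j : ℝ) + (K + 1 / 4)) ^ (p + 1))⁻¹)) h ∧ MI.mem S h (hurwitzBox S J ν K p) := by
  have hc : (0 : ℚ) < (K : ℚ) + 1 / 4 := by positivity
  obtain ⟨hsum, hle⟩ := abs_tsum_inv_pow_sub_hurwitzNatMain_le hc (s := p + 1) (by omega) J hν
  have hcast : ∀ j : ℕ, (((j : ℝ) + (((K : ℚ) + 1 / 4 : ℚ) : ℝ)) ^ (p + 1))⁻¹ =
      ((((j : ℝ) + (K + 1 / 4)) ^ (p + 1))⁻¹) := fun j ↦ by push_cast; ring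
  simp_rw [hcast] at hsum hle
  refine ⟨_, hsum.hasSum, ?_⟩
  set T : ℝ := ∑' j : ℕ, (((j : ℝ) + (K + 1 / 4)) ^ (p + 1))⁻¹
  set m : ℚ := hurwitzNatMain ((K : ℚ) + 1 / 4) J ν (p + 1)
  set t : ℚ := hurwitzNatTail ((K : ℚ) + 1 / 4) J ν (p + 1)
  have h1 : ((m - t : ℚ) : ℝ) ≤ T := by push_cast; linarith [(abs_le.1 hle).1]
  have h2 : T ≤ ((m + t : ℚ) : ℝ) := by push_cast; linarith [(abs_le.1 hle).2]
  have hlo := (mem_ratBox S (m - t)).1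
  have hhi := (mem_ratBox S (m + t)).2
  have hS0 : (0 : ℝ) ≤ S := Nat.cast_nonneg S
  refine ⟨hlo.trans (mul_le_mul_of_nonneg_right h1 hS0), le_trans (mul_le_mul_of_nonneg_right h2 hS0) hhi⟩

/-! ## Parameters and the self-contained box -/

/-- Evaluation parameters of the window-constant boxes. -/
structure Params where
  /-- binary scale of all intervals -/
  S : ℕ
  /-- number of series terms for `exp` -/
  Kser : ℕ
  /-- number of argument halvings for `exp` (`a(4K+1)/2^kred` must be small) -/
  kred : ℕ
  /-- number of near nodes summed in closed form -/
  K : ℕ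
  /-- Euler–Maclaurin shift for the far main part -/
  J : ℕ
  /-- Euler–Maclaurin order for the far main part (`≥ 1`) -/
  ν : ℕ
  deriving Repr, Inhabited

/-- `W_p(a)`-box with the Hurwitz input produced internally. -/
def winConstBoxP (prm : Params) (a : ℚ) (p : ℕ) : Option MI :=
  winConstBox prm.S prm.Kser prm.kred a p prm.K (hurwitzBox prm.S prm.J prm.ν prm.K p)

/-- **`winConstBoxP ∋ W_p(a)`** (`a > 0` rational, `p ≥ 1`, `ν ≥ 1`). -/
theorem mem_winConstBoxP {prm : Params} (hS : 0 < prm.S) (hν : prm.ν ≠ 0) {a : ℚ} (ha : 0 < a) {p : ℕ} (hp : 1 ≤ p)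
    {W : MI} (hW : winConstBoxP prm a p = some W) :
    MI.mem prm.S (∫ t in Ioc 0 (2 * (a : ℝ)), weilArchDensity t * t ^ p) W :=
  mem_winConstBox hS ha hp (hurwitzBox_spec prm.S prm.J hν prm.K hp) hW

/-! ## Claimed tables -/

/-- The checker: recompute every entry and test containment. -/
def checkWinConstTable (prm : Params) (a : ℚ) (tab : List MI) : Bool :=
  (List.range tab.length).all fun i ↦
    match winConstBoxP prm a (i + 1) with
    | some W => within W (tab.getD i default)
    | none => false

/-- **Soundness of `checkWinConstTable`**: in a table that passes the check, entry `i` contains `W_{i+1}(a)`. -/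
theorem mem_of_checkWinConstTable {prm : Params} (hS : 0 < prm.S) (hν : prm.ν ≠ 0) {a : ℚ} (ha : 0 < a)
    {tab : List MI} (h : checkWinConstTable prm a tab = true) {i : ℕ} (hi : i < tab.length) :
    MI.mem prm.S (∫ t in Ioc 0 (2 * (a : ℝ)), weilArchDensity t * t ^ (i + 1)) (tab.getD i default) := by
  rw [checkWinConstTable, List.all_eq_true] at h
  have hi' := h i (List.mem_range.2 hi)
  split at hi'
  · rename_i W hW
    exact mem_of_within hi' (mem_winConstBoxP hS hν ha (by omega) hW)
  · simp at hi'

end WinConst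

end Summit.RiemannHypothesis.RiemannHypothesis.Theorems.WeilFormatC
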